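import Summits.CriticalPhenomena.Ising3DConformalLimit.Theorems.HyperoctahedralRPExistsScaleCovariantLimitFunnelDoublingIffAxisRate
import Summits.CriticalPhenomena.Ising3DConformalLimit.Theorems.MirrorHoelderCompactnessTwoPointDoublingStubLeanScalePropagation
import Summits.CriticalPhenomena.Ising3DConformalLimit.Theorems.HyperoctahedralRPExistsScaleCovariantLimitFoldedCurrentSqrtDoublingBoxSum
import HarnessLib

/-!
# Line `folded-current-repulsion`, engine F2 (= item 6150): the √n-doubling partial — the Duminil-Copin–Panis denominator

Lead `prover-line-stmt-CriticalPhenomena-1981-c15-0` (crux `ExistsScaleCovariantLimit`, stmt-CriticalPhenomena-1981), registered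
sub-goal `dcp_head_level_bound`. Write `g(n) = ⟨σ₀σ_{ne₀}⟩_{β_c(3)}`, `χ_M = Σ_{‖x‖_∞ ≤ M} ⟨σ₀σ_x⟩_{β_c(3)}`. Duminil-Copin–Panis,
Theorem 1.3 (proved in the tree, `dcp_axis_lower_three`) at scale `2n` reads `g(2n) ≥ c₁ / (χ_{8n} + 2n Σ_{k≤4n} k g(k))`. This file
bounds the denominator by the HEAD SUM `S = Σ_{k≤n} k g(k)` and the LEVEL `g(n)`:

* `dcp_denominator_le`: `χ_{8n} + 2nΣ_{k≤4n} k g(k) ≤ 1 + 56 n S + 24216 n³ g(n)` — the box sum against the axis profile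
  (`box_sum_le_axis_sum`: sup-norm Messager–Miracle-Solé + shell counting, `χ_M ≤ 1 + Σ_{k≤M} 54 k² g(k)`), `k² ≤ n k` below `n` and
  `g(k) ≤ g(n)`, `k ≤ 8n` beyond;
* `axis_sq_level_ge`: the Simon–Lieb level `c₀ ≤ n² g(n)`;
* `dcp_head_level_bound` (registered): `∃ c₁ > 0, ∃ N₁, ∀ n ≥ 1, 2n ≥ N₁ → c₁ ≤ g(2n)·(1 + 56 n S + 24216 n³ g(n))`.

References: H. Duminil-Copin, R. Panis, CMP 406 (2025) = arXiv:2404.05700, Theorem 1.3; A. Messager, S. Miracle-Solé, J. Stat. Phys. 17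
(1977); B. Simon, CMP 77 (1980).
-/

noncomputable section

open Finset Real
open scoped BigOperators
open Literature.Probability.LatticeModels

namespace Summit.CriticalPhenomena.Ising3DConformalLimit.Cruxes.ExistsScaleCovariantLimit.FoldedCurrentRepulsion


open Summit.CriticalPhenomena.Ising3DConformalLimit.Cruxes.TwoPointDoubling.Birth (dcp_axis_lower_three)

/-! ### Splitting axial sums at the scale `n` -/

/-- `Σ_{k=1}^{b} f = Σ_{k=1}^{a} f + Σ_{k=a+1}^{b} f` for `a ≤ b`. [folklore] -/
theorem sum_Icc_one_split (f : ℕ → ℝ) {a b : ℕ} (hab : a ≤ b) :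
    ∑ k ∈ Icc 1 b, f k = ∑ k ∈ Icc 1 a, f k + ∑ k ∈ Ioc a b, f k := by
  have e : ∀ m : ℕ, Icc 1 m = Ioc 0 m := fun m => by
    ext k; simp only [mem_Icc, mem_Ioc]; omega
  rw [e, e, Finset.sum_Ioc_consecutive f (Nat.zero_le a) hab]

/-- **The Duminil-Copin–Panis denominator at scale `2n` against the head sum and the level at `n`.**
`χ_{8n} + 2n·Σ_{k≤4n} k g(k) ≤ 1 + 56 n·S + 24216 n³ g(n)`, `S = Σ_{k≤n} k g(k)` (box sum against the axis profile, then
`g(k) ≤ g(n)` beyond `n`). [cite: MessagerMiracleSoleJSP1977, main theorem (monotonicity of ⟨σ₀σ_x⟩ under reflections)] -/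
theorem dcp_denominator_le {n : ℕ} (hn : 1 ≤ n) :
    (∑ x ∈ box 3 (4 * (2 * n)), criticalTwoPoint 3 x) +
        ((2 * n : ℕ) : ℝ) * ∑ k ∈ Icc 1 (2 * (2 * n)), (k : ℝ) * criticalTwoPoint 3 (Pi.single 0 (k : ℤ)) ≤
      1 + 56 * n * (∑ k ∈ Icc 1 n, (k : ℝ) * criticalTwoPoint 3 (Pi.single 0 (k : ℤ))) +
        24216 * (n : ℝ) ^ 3 * criticalTwoPoint 3 (Pi.single 0 (n : ℤ)) := by
  set g : ℕ → ℝ := fun m => criticalTwoPoint 3 (Pi.single 0 (m : ℤ)) with hg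
  set S : ℝ := ∑ k ∈ Icc 1 n, (k : ℝ) * g k with hS
  have hgn : ∀ m, 0 ≤ g m := fun m => criticalTwoPoint_nonneg' _
  have hanti : Antitone g := Funnel.criticalTwoPoint_axis_antitone 0
  have hn0 : (0 : ℝ) ≤ n := by positivity
  have e8 : 4 * (2 * n) = 8 * n := by ring
  have e4 : 2 * (2 * n) = 4 * n := by ring
  rw [e8, e4]
  -- box part
  have hbox : ∑ x ∈ box 3 (8 * n), criticalTwoPoint 3 x ≤ 1 + 54 * n * S + 24192 * (n : ℝ) ^ 3 * g n := by
    refine (box_sum_le_axis_sum (8 * n)).trans ?_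
    rw [sum_Icc_one_split (fun k : ℕ => 54 * (k : ℝ) ^ 2 * g k) (show n ≤ 8 * n by omega)]
    have h1 : ∑ k ∈ Icc 1 n, 54 * (k : ℝ) ^ 2 * g k ≤ 54 * n * S := by
      rw [hS, Finset.mul_sum]
      refine Finset.sum_le_sum fun k hk => ?_
      rw [mem_Icc] at hk
      have hk' : (k : ℝ) ≤ n := by exact_mod_cast hk.2
      have hk0 : (0 : ℝ) ≤ k := by positivity
      have := hgn k
      calc 54 * (k : ℝ) ^ 2 * g k = (k : ℝ) * (54 * ((k : ℝ) * g k)) := by ring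
        _ ≤ (n : ℝ) * (54 * ((k : ℝ) * g k)) := mul_le_mul_of_nonneg_right hk' (by positivity)
        _ = 54 * n * ((k : ℝ) * g k) := by ring
    have h2 : ∑ k ∈ Ioc n (8 * n), 54 * (k : ℝ) ^ 2 * g k ≤ 24192 * (n : ℝ) ^ 3 * g n := by
      calc ∑ k ∈ Ioc n (8 * n), 54 * (k : ℝ) ^ 2 * g k ≤ ∑ _k ∈ Ioc n (8 * n), 54 * (8 * n : ℝ) ^ 2 * g n := by
            refine Finset.sum_le_sum fun k hk => ?_
            rw [mem_Ioc] at hk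
            have hk8 : (k : ℝ) ≤ 8 * n := by exact_mod_cast hk.2
            have hk0 : (0 : ℝ) ≤ k := by positivity
            have hgk : g k ≤ g n := hanti hk.1.le
            calc 54 * (k : ℝ) ^ 2 * g k ≤ 54 * (8 * n : ℝ) ^ 2 * g k :=
                  mul_le_mul_of_nonneg_right (by nlinarith) (hgn k)
              _ ≤ 54 * (8 * n : ℝ) ^ 2 * g n := mul_le_mul_of_nonneg_left hgk (by positivity)
        _ = (7 * n : ℕ) * (54 * (8 * n : ℝ) ^ 2 * g n) := by
            rw [Finset.sum_const, Nat.card_Ioc, show 8 * n - n = 7 * n by omega, nsmul_eq_mul]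
        _ = 24192 * (n : ℝ) ^ 3 * g n := by push_cast; ring
    linarith
  -- axis part
  have hax : ((2 * n : ℕ) : ℝ) * ∑ k ∈ Icc 1 (4 * n), (k : ℝ) * g k ≤ 2 * n * S + 24 * (n : ℝ) ^ 3 * g n := by
    rw [sum_Icc_one_split (fun k : ℕ => (k : ℝ) * g k) (show n ≤ 4 * n by omega)]
    have h2 : ∑ k ∈ Ioc n (4 * n), (k : ℝ) * g k ≤ 12 * (n : ℝ) ^ 2 * g n := by
      calc ∑ k ∈ Ioc n (4 * n), (k : ℝ) * g k ≤ ∑ _k ∈ Ioc n (4 * n), (4 * n : ℝ) * g n := by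
            refine Finset.sum_le_sum fun k hk => ?_
            rw [mem_Ioc] at hk
            have hk4 : (k : ℝ) ≤ 4 * n := by exact_mod_cast hk.2
            exact mul_le_mul hk4 (hanti hk.1.le) (hgn k) (by positivity)
        _ = (3 * n : ℕ) * ((4 * n : ℝ) * g n) := by
            rw [Finset.sum_const, Nat.card_Ioc, show 4 * n - n = 3 * n by omega, nsmul_eq_mul]
        _ = 12 * (n : ℝ) ^ 2 * g n := by push_cast; ring
    have hSnn : 0 ≤ S := Finset.sum_nonneg fun k _ => mul_nonneg (by positivity) (hgn k)
    push_cast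
    nlinarith [h2, hSnn, hgn n]
  linarith

/-- The critical axis function is bounded below on the level of `n²`: `c ≤ n²·g(n)` for `n ≥ 1`, `c > 0`
(Simon–Lieb lower bound `c‖x‖⁻² ≤ ⟨σ₀σ_x⟩_{β_c}` at `x = n e₀`). [cite: Simon1980, Thm. 1] -/
theorem axis_sq_level_ge : ∃ c : ℝ, 0 < c ∧ ∀ n : ℕ, 1 ≤ n → c ≤ (n : ℝ) ^ 2 * criticalTwoPoint 3 (Pi.single 0 (n : ℤ)) := by
  obtain ⟨c, C, hc, hb⟩ := criticalTwoPoint_bounds_holds (d := 3) le_rfl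
  refine ⟨c, hc, fun n hn => ?_⟩
  have hnorm : ‖(Pi.single 0 (n : ℤ) : Site 3)‖ = (n : ℝ) := by
    rw [Pi.norm_single, Int.norm_natCast]
  have hn0 : (0 : ℝ) < n := by exact_mod_cast hn
  have hx : (Pi.single 0 (n : ℤ) : Site 3) ≠ 0 := by
    rw [← norm_pos_iff, hnorm]; exact hn0
  have hlo := (hb _ hx).1
  rw [hnorm, show (-(((3 : ℕ) : ℝ) - 1)) = -2 by norm_num, Real.rpow_neg hn0.le, Real.rpow_two,
    ← div_eq_mul_inv, div_le_iff₀ (by positivity)] at hlo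
  linarith

/-- **Duminil-Copin–Panis at scale `2n`, against head sum and level.** There are `c₁ > 0` and `N₁` with
`c₁ ≤ g(2n)·(1 + 56 n Σ_{k≤n} k g(k) + 24216 n³ g(n))` for all `n ≥ 1` with `2n ≥ N₁` (Theorem 1.3 at `2n`, the
denominator bounded by `dcp_denominator_le`). [cite: DuminilCopinPanis2025LowerBounds, Theorem 1.3] -/
theorem dcp_head_level_bound : ∃ c₁ : ℝ, 0 < c₁ ∧ ∃ N₁ : ℕ, ∀ n : ℕ, 1 ≤ n → N₁ ≤ 2 * n → c₁ ≤ criticalTwoPoint 3 (Pi.single 0 ((2 * n : ℕ) : ℤ)) * (1 + 56 * n * (∑ k ∈ Icc 1 n, (k : ℝ) * criticalTwoPoint 3 (Pi.single 0 (k : ℤ))) + 24216 * (n : ℝ) ^ 3 * criticalTwoPoint 3 (Pi.single 0 (n : ℤ))) := by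
  obtain ⟨c₁, hc₁, N₁, _hN₁, hdcp⟩ := dcp_axis_lower_three
  refine ⟨c₁, hc₁, N₁, fun n hn hN => ?_⟩
  have hD := hdcp (2 * n) hN
  have hDen_pos : 0 < (∑ x ∈ box 3 (4 * (2 * n)), criticalTwoPoint 3 x) +
      ((2 * n : ℕ) : ℝ) * ∑ k ∈ Icc 1 (2 * (2 * n)), (k : ℝ) * criticalTwoPoint 3 (Pi.single 0 (k : ℤ)) := by
    have h0 : (1 : ℝ) ≤ ∑ x ∈ box 3 (4 * (2 * n)), criticalTwoPoint 3 x := by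
      have hmem : (0 : Site 3) ∈ box 3 (4 * (2 * n)) := zero_mem_box _ _
      have h := Finset.single_le_sum (f := fun x => criticalTwoPoint 3 x) (fun x _ => criticalTwoPoint_nonneg' x) hmem
      rw [criticalTwoPoint_zero'] at h
      exact h
    have h1 : 0 ≤ ((2 * n : ℕ) : ℝ) * ∑ k ∈ Icc 1 (2 * (2 * n)), (k : ℝ) * criticalTwoPoint 3 (Pi.single 0 (k : ℤ)) :=
      mul_nonneg (by positivity) (Finset.sum_nonneg fun k _ => mul_nonneg (by positivity) (criticalTwoPoint_nonneg' _))
    linarith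
  have hc1 := (div_le_iff₀ hDen_pos).1 hD
  exact hc1.trans (mul_le_mul_of_nonneg_left (dcp_denominator_le hn) (criticalTwoPoint_nonneg' _))

end Summit.CriticalPhenomena.Ising3DConformalLimit.Cruxes.ExistsScaleCovariantLimit.FoldedCurrentRepulsion

end
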